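import Summits.HubbardSuperconductivity.HubbardSuperconductivity.Theorems.SoloBlindDimerStrongCoupling
import Literature.MathematicalPhysics.QuantumLattice.HubbardDWaveCarrierCeiling
import HarnessLib

/-!
# The carrier ceiling survives the crutch: at strong coupling the crutch-induced order is carrier-scale

Solo-blind lineage, Theorem 40 (generation 40). Setting: the BCS-crutch family
`K_{U,g} = hubbardTorus 2 L 1 U - (g/L²) Δ_dᴴΔ_d` of Theorems 23–38 (`g ≥ 0`, sector
`(2n, S^z = 0)`, `L ≥ 3`), a normalised sector ground state `φ` of `K_{U,g}`, and the numbers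
`T = re⟨φ, H₀ φ⟩`, `D = re⟨φ, Σ_x n_{x↑}n_{x↓} φ⟩` (doublons), `Y = re⟨φ, Δ_dᴴΔ_d φ⟩`
(`d`-wave pair order; density `Y/L⁴`).

The tree's Literature holds the CARRIER CEILING for the pure model (`g = 0`): for every
`N`-particle vector `Y ≤ 80 L² ((L² - N + 3)‖ψ‖² + 2D)`
(`PairFieldCarrier.re_expect_pairField_dWave_conjTranspose_mul_le_carrier`, Zhang–Gros–Rice–Shiba
1988 §2 / Scalapino 1995 §2: every singlet term of `Δ_d` needs an empty site or a doublon), and for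
ground states of `H_U` the doublon budget `U·D ≤ 4N` (`hubbardTorus_groundState_doublon_le`), whence
every ground-state family of the summit has order density `≤ 80δ + 640/U`
(`liminf_dWavePairFieldCorr_le_carrier`).  This file transfers the ceiling to the crutch plane and
closes it against the lineage's strong-coupling FLOOR (Theorem 34):

* `crutch_minEnergyOn_le_zero` — **(a)** `minEnergyOn K_{U,g} (2n, 0) ≤ 0` for `g ≥ 0`, `2n ≤ L²`
  (Theorem 24(a) with the order functional `≥ 0`, against the tree's doublon-free configuration
  `minEnergyOn_szSector_hubbardTorus_le_zero`).
* `crutch_groundState_doublon_budget` — **(b)** `U·D ≤ 8n + (g/L²)·Y`: on the crutch plane the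
  doublon budget of a ground state grows exactly by its crutch energy `w = (g/L²)Y` (free floor
  `T ≥ -8n`, `re_expect_hubbardTorus_zero_ge`).
* `crutch_groundState_carrier_ceiling` — **(c)** `(U - 160 g)·Y ≤ 80 U L²(L² - 2n + 3) + 1280 L² n`
  (`U ≥ 0`): the carrier ceiling with the budget (b) fed back; the crutch enters only through the
  factor `U - 160g`.
* `crutch_groundState_carrier_ceiling_of_le` / `…_doped` — **(d)** for `U ≥ 320 g`, `U > 0`:
  `Y ≤ 160 L²(L² - 2n + 3) + 2560 L² n/U`; in the doped sector `n = ⌊(1-δ)L²/2⌋`, `δ ∈ [0,1]`: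
  `Y ≤ 160 L² (δL² + 5 + 8L²/U)`, i.e. density `≤ 160δ + 1280/U + 800/L²`.
* `liminf_dWavePairFieldCorr_crutch_le_carrier` — **(e)** the summit's order functional of EVERY
  normalised ground-state family of `K_{U,g}` in the summit's sectors has `liminf ≤ 160δ + 1280/U`
  whenever `U ≥ 320 g` (at `g = 0` this is the tree's ceiling with the constants doubled).
* `strongCoupling_crutch_order_two_sided` — **(f) THE TWO-SIDED CARRIER LAW.** For
  `δ ∈ (0, 1/2)`, `g ≥ 48`, `U ≥ max (64/δ, 320 g)` and every even side `L ≥ max (4, 4/δ)`, EVERY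
  normalised ground state of `K_{U,g}` in the sector `(2⌊(1-δ)L²/2⌋, 0)` satisfies
  **`δ L⁴/g ≤ Y ≤ 180 δ L⁴ + 800 L²`**: the floor is Theorem 34 (`strongCoupling_trial` + Theorem
  24(c) `crutch_groundState_order_ge_of_trial`), the ceiling is (d) with `1280/U ≤ 20δ`.

Reading (obstruction report §5.20). In the strong-coupling part of the `(U, g)` plane the order that
the crutch forces on every ground state (Theorems 33/34) is OF THE EXACT ORDER OF THE HOLE DENSITY,
`Y/L⁴ ≍ δ` uniformly in `L`, pinned from both sides with constants depending on `g` only through the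
floor `δ/g`: the explicit attraction cannot lift the every-ground-state order above the Gutzwiller
(carrier) scale once `U ≥ 320 g`, and it does produce that scale once `g ≥ 48`, `Uδ ≥ 64`. Inside the
OPEN box of obstruction W3 (`0 < g ≤ 8/δ`, `U > U₀(g)`) the ceiling (d)/(e) holds as well; what is
open there is never the size of the order but its existence as `g → 0⁺`. Honest label:
corollary-grade — the kinematic input is the tree's carrier bound (cited, not re-proved), the
dynamic inputs are the doublon-free competitor and the lineage's Theorems 24 and 34; `U` is used only
through the doublon budget. No claim toward the summit. [this work; inputs folklore]
-/

noncomputable section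

namespace Summit.HubbardSuperconductivity.HubbardSuperconductivity.Theorems.CrutchCarrierCeiling

open Matrix Finset Filter Literature.Probability.LatticeModels
  Literature.MathematicalPhysics.QuantumLattice
  Literature.MathematicalPhysics.QuantumLattice.EigenvalueContinuation
open scoped ComplexOrder

variable {L : ℕ} [NeZero L]

/-! ### Rayleigh-quotient bookkeeping -/

/-- Splitting of a Rayleigh quotient of `A + c • B` (`c` real) into real parts. [folklore] -/
private theorem re_rayleigh_add_real_smul {ι : Type*} [Fintype ι] (A B : Matrix ι ι ℂ) (c : ℝ)
    (v : ι → ℂ) :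
    (star v ⬝ᵥ ((A + ((c : ℝ) : ℂ) • B) *ᵥ v)).re =
      (star v ⬝ᵥ (A *ᵥ v)).re + c * (star v ⬝ᵥ (B *ᵥ v)).re := by
  rw [add_mulVec, Matrix.smul_mulVec, dotProduct_add, dotProduct_smul, smul_eq_mul, Complex.add_re,
    Complex.re_ofReal_mul]

omit [NeZero L] in
/-- `re⟨v, H_U v⟩ = re⟨v, H₀ v⟩ + U · re⟨v, D v⟩` with `D = Σ_x n_{x↑} n_{x↓}`. [folklore] -/
private theorem re_rayleigh_hubbardTorus_split (U : ℝ) (v : Fock (Orb (FermionTorus 2 L))) :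
    (star v ⬝ᵥ (hubbardTorus 2 L 1 U *ᵥ v)).re =
      (star v ⬝ᵥ (hubbardTorus 2 L 1 0 *ᵥ v)).re +
        U * (star v ⬝ᵥ ((∑ x : FermionTorus 2 L, numberOp x 0 * numberOp x 1 :
          Matrix (Finset (Orb (FermionTorus 2 L))) _ ℂ) *ᵥ v)).re := by
  rw [hubbardTorus_eq_zero_add_smul_interaction U]
  exact re_rayleigh_add_real_smul _ _ U v

/-- `re⟨v, K_{U,g} v⟩ = re⟨v, H₀ v⟩ + U · re⟨v, D v⟩ - (g/L²) · re⟨v, Δ_dᴴΔ_d v⟩`. [folklore] -/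
private theorem re_rayleigh_crutch_split (U g : ℝ) (v : Fock (Orb (FermionTorus 2 L))) :
    (star v ⬝ᵥ ((hubbardTorus 2 L 1 U + ((-(g / (L : ℝ) ^ 2) : ℝ) : ℂ) •
        ((pairField dWaveFormFactor L)ᴴ * pairField dWaveFormFactor L)) *ᵥ v)).re =
      (star v ⬝ᵥ (hubbardTorus 2 L 1 0 *ᵥ v)).re +
        U * (star v ⬝ᵥ ((∑ x : FermionTorus 2 L, numberOp x 0 * numberOp x 1 :
          Matrix (Finset (Orb (FermionTorus 2 L))) _ ℂ) *ᵥ v)).re -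
        g / (L : ℝ) ^ 2 *
          (star v ⬝ᵥ (((pairField dWaveFormFactor L)ᴴ * pairField dWaveFormFactor L) *ᵥ v)).re := by
  rw [re_rayleigh_add_real_smul, re_rayleigh_hubbardTorus_split]
  ring

/-! ### (a) The crutched sector minimum is non-positive -/

/-- **(a)** For `g ≥ 0` and `2n ≤ L²` (non-trivial sector), `minEnergyOn K_{U,g} (2n, S^z = 0) ≤ 0`:
by Theorem 24(a) (`CrutchAxis.minEnergyOn_crutch_le`, the order functional of a ground state of `H_U`
is `≥ 0`) the crutched minimum is below the Hubbard minimum, which is `≤ 0` by the tree's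
doublon-free configuration (`minEnergyOn_szSector_hubbardTorus_le_zero`, Tasaki 1998 §5.1).
[this work; inputs folklore] -/
theorem crutch_minEnergyOn_le_zero (U : ℝ) {g : ℝ} (hg : 0 ≤ g) {n : ℕ} (hn : 2 * n ≤ L ^ 2)
    (hK : szSector (Λ := FermionTorus 2 L) (2 * n) 0 ≠ ⊥) :
    (hubbardTorus 2 L 1 U + ((-(g / (L : ℝ) ^ 2) : ℝ) : ℂ) •
        ((pairField dWaveFormFactor L)ᴴ * pairField dWaveFormFactor L)).minEnergyOn
          (szSector (Λ := FermionTorus 2 L) (2 * n) 0) ≤ 0 := by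
  classical
  have hHh := isHermitian_hubbardTorus L 1 U
  have hOh : ((pairField dWaveFormFactor L)ᴴ * pairField dWaveFormFactor L).IsHermitian :=
    isHermitian_conjTranspose_mul_self _
  obtain ⟨φ₀, hφ₀K, hφ₀1, hφ₀E⟩ := exists_unit_eigen_minEnergyOn hHh
    (szSector (Λ := FermionTorus 2 L) (2 * n) 0)
    (fun v hv => hubbardTorus_mulVec_mem_szSector 1 U hv) hK
  have hO0 : (0 : ℝ) ≤
      (star φ₀ ⬝ᵥ ((pairField dWaveFormFactor L)ᴴ * pairField dWaveFormFactor L) *ᵥ φ₀).re :=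
    (posSemidef_conjTranspose_mul_self (pairField dWaveFormFactor L)).re_dotProduct_nonneg φ₀
  have h := CrutchAxis.minEnergyOn_crutch_le hHh hOh _ hφ₀K hφ₀1 hφ₀E hO0
    (t := g / (L : ℝ) ^ 2) (by positivity)
  have h0 := minEnergyOn_szSector_hubbardTorus_le_zero L U hn
  have hz : g / (L : ℝ) ^ 2 * 0 = 0 := mul_zero _
  linarith

/-! ### (b) The doublon budget on the crutch plane -/

/-- **(b) Doublon budget of a crutched ground state.** `L ≥ 3`, `U` real, `g ≥ 0`, `2n ≤ L²`; `φ` a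
normalised ground state of `K_{U,g}` in the sector `(2n, S^z = 0)`. Then
`U · re⟨φ, D φ⟩ ≤ 8n + (g/L²) · re⟨φ, Δ_dᴴΔ_d φ⟩`: `E_K = T + U·D - (g/L²)Y ≤ 0` by (a) and
`T ≥ -8n` (`re_expect_hubbardTorus_zero_ge`). At `g = 0` this is the tree's
`hubbardTorus_groundState_doublon_le`. [this work; inputs folklore] -/
theorem crutch_groundState_doublon_budget (hL : 3 ≤ L) (U : ℝ) {g : ℝ} (hg : 0 ≤ g) {n : ℕ}
    (hn : 2 * n ≤ L ^ 2) {φ : Fock (Orb (FermionTorus 2 L))} (hφ1 : star φ ⬝ᵥ φ = 1)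
    (hφ : IsGroundStateInSector
      (hubbardTorus 2 L 1 U + ((-(g / (L : ℝ) ^ 2) : ℝ) : ℂ) •
        ((pairField dWaveFormFactor L)ᴴ * pairField dWaveFormFactor L)) (2 * n) 0 φ) :
    U * (star φ ⬝ᵥ ((∑ x : FermionTorus 2 L, numberOp x 0 * numberOp x 1 :
        Matrix (Finset (Orb (FermionTorus 2 L))) _ ℂ) *ᵥ φ)).re ≤
      8 * (n : ℝ) + g / (L : ℝ) ^ 2 *
        (star φ ⬝ᵥ (((pairField dWaveFormFactor L)ᴴ * pairField dWaveFormFactor L) *ᵥ φ)).re := by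
  obtain ⟨hmem, hne, hKφ⟩ := hφ
  have hK : szSector (Λ := FermionTorus 2 L) (2 * n) 0 ≠ ⊥ := by
    intro hbot
    rw [hbot, Submodule.mem_bot] at hmem
    exact hne hmem
  have hsec : IsInSector n n φ := (mem_szSector_two_mul_zero_iff n φ).1 hmem
  have hE :=
    _root_.Literature.MathematicalPhysics.QuantumLattice.re_rayleigh_of_eigen_minEnergyOn _ _ hφ1 hKφ
  rw [re_rayleigh_crutch_split] at hE
  have hE0 := crutch_minEnergyOn_le_zero (L := L) U hg hn hK
  have hT := re_expect_hubbardTorus_zero_ge L hL hsec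
  rw [hφ1, Complex.one_re, mul_one] at hT
  linarith

/-! ### (c)–(d) The carrier ceiling on the crutch plane -/

/-- **(c) Carrier ceiling on the crutch plane (parametric form).** `L ≥ 3`, `U ≥ 0`, `g ≥ 0`,
`2n ≤ L²`; `φ` a normalised ground state of `K_{U,g}` in the sector `(2n, 0)`. Then
`(U - 160 g) · re⟨φ, Δ_dᴴΔ_d φ⟩ ≤ 80 U L² (L² - 2n + 3) + 1280 L² n`: the tree's carrier bound
`Y ≤ 80 L² ((L² - 2n + 3) + 2D)` times `U`, with `U·D ≤ 8n + (g/L²)Y` from (b).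
[this work; inputs folklore] -/
theorem crutch_groundState_carrier_ceiling (hL : 3 ≤ L) {U : ℝ} (hU : 0 ≤ U) {g : ℝ} (hg : 0 ≤ g)
    {n : ℕ} (hn : 2 * n ≤ L ^ 2) {φ : Fock (Orb (FermionTorus 2 L))} (hφ1 : star φ ⬝ᵥ φ = 1)
    (hφ : IsGroundStateInSector
      (hubbardTorus 2 L 1 U + ((-(g / (L : ℝ) ^ 2) : ℝ) : ℂ) •
        ((pairField dWaveFormFactor L)ᴴ * pairField dWaveFormFactor L)) (2 * n) 0 φ) :
    (U - 160 * g) *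
        (star φ ⬝ᵥ (((pairField dWaveFormFactor L)ᴴ * pairField dWaveFormFactor L) *ᵥ φ)).re ≤
      80 * U * (L : ℝ) ^ 2 * ((L : ℝ) ^ 2 - 2 * n + 3) + 1280 * (L : ℝ) ^ 2 * n := by
  have hN : IsNParticle (2 * n) φ := ((mem_szSector_iff (2 * n) 0 φ).1 hφ.1).1
  have hcar := PairFieldCarrier.re_expect_pairField_dWave_conjTranspose_mul_le_carrier L hN
  rw [hφ1, Complex.one_re, mul_one] at hcar
  push_cast at hcar
  have hd := crutch_groundState_doublon_budget hL U hg hn hφ1 hφ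
  have hL0 : (L : ℝ) ≠ 0 := by exact_mod_cast (NeZero.ne L)
  have hL2 : (0 : ℝ) ≤ (L : ℝ) ^ 2 := by positivity
  have h1 := mul_le_mul_of_nonneg_left hcar hU
  have h3 := mul_le_mul_of_nonneg_left hd (show (0 : ℝ) ≤ 160 * (L : ℝ) ^ 2 by positivity)
  have h2 : (L : ℝ) ^ 2 * (g / (L : ℝ) ^ 2 *
      (star φ ⬝ᵥ (((pairField dWaveFormFactor L)ᴴ * pairField dWaveFormFactor L) *ᵥ φ)).re) =
      g * (star φ ⬝ᵥ (((pairField dWaveFormFactor L)ᴴ * pairField dWaveFormFactor L) *ᵥ φ)).re := by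
    field_simp
  linarith

/-- **(d) Carrier ceiling on the crutch plane, `U ≥ 320 g`.** With `U > 0` in addition:
`re⟨φ, Δ_dᴴΔ_d φ⟩ ≤ 160 L² (L² - 2n + 3) + 2560 L² n / U` — twice the `g = 0` ceiling.
[this work; inputs folklore] -/
theorem crutch_groundState_carrier_ceiling_of_le (hL : 3 ≤ L) {U : ℝ} (hU : 0 < U) {g : ℝ}
    (hg : 0 ≤ g) (hUg : 320 * g ≤ U) {n : ℕ} (hn : 2 * n ≤ L ^ 2)
    {φ : Fock (Orb (FermionTorus 2 L))} (hφ1 : star φ ⬝ᵥ φ = 1)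
    (hφ : IsGroundStateInSector
      (hubbardTorus 2 L 1 U + ((-(g / (L : ℝ) ^ 2) : ℝ) : ℂ) •
        ((pairField dWaveFormFactor L)ᴴ * pairField dWaveFormFactor L)) (2 * n) 0 φ) :
    (star φ ⬝ᵥ (((pairField dWaveFormFactor L)ᴴ * pairField dWaveFormFactor L) *ᵥ φ)).re ≤
      160 * (L : ℝ) ^ 2 * ((L : ℝ) ^ 2 - 2 * n + 3) + 2560 * (L : ℝ) ^ 2 * n / U := by
  have hc := crutch_groundState_carrier_ceiling hL hU.le hg hn hφ1 hφ
  have hY : (0 : ℝ) ≤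
      (star φ ⬝ᵥ (((pairField dWaveFormFactor L)ᴴ * pairField dWaveFormFactor L) *ᵥ φ)).re :=
    (posSemidef_conjTranspose_mul_self (pairField dWaveFormFactor L)).re_dotProduct_nonneg φ
  have hrhs : 160 * (L : ℝ) ^ 2 * ((L : ℝ) ^ 2 - 2 * n + 3) + 2560 * (L : ℝ) ^ 2 * n / U =
      (160 * U * (L : ℝ) ^ 2 * ((L : ℝ) ^ 2 - 2 * n + 3) + 2560 * (L : ℝ) ^ 2 * n) / U := by
    field_simp
  rw [hrhs, le_div_iff₀ hU]
  nlinarith [mul_le_mul_of_nonneg_right hUg hY]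

/-- **(d′) The doped sector.** `L ≥ 3`, `δ ∈ [0, 1]`, `U > 0`, `0 ≤ g`, `U ≥ 320 g`; `φ` a normalised
ground state of `K_{U,g}` in the sector `(2⌊(1-δ)L²/2⌋, S^z = 0)`. Then
`re⟨φ, Δ_dᴴΔ_d φ⟩ ≤ 160 L² (δ L² + 5 + 8 L²/U)` (density `≤ 160δ + 1280/U + 800/L²`); compare the
tree's `re_expect_pairField_dWave_le_carrier_of_groundState` (`g = 0`, constant `80`).
[this work; inputs folklore] -/
theorem crutch_groundState_carrier_ceiling_doped (hL : 3 ≤ L) {δ U g : ℝ} (hδ0 : 0 ≤ δ)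
    (hδ1 : δ ≤ 1) (hU : 0 < U) (hg : 0 ≤ g) (hUg : 320 * g ≤ U)
    {φ : Fock (Orb (FermionTorus 2 L))} (hφ1 : star φ ⬝ᵥ φ = 1)
    (hφ : IsGroundStateInSector
      (hubbardTorus 2 L 1 U + ((-(g / (L : ℝ) ^ 2) : ℝ) : ℂ) •
        ((pairField dWaveFormFactor L)ᴴ * pairField dWaveFormFactor L))
      (2 * ⌊(1 - δ) * (L : ℝ) ^ 2 / 2⌋₊) 0 φ) :
    (star φ ⬝ᵥ (((pairField dWaveFormFactor L)ᴴ * pairField dWaveFormFactor L) *ᵥ φ)).re ≤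
      160 * (L : ℝ) ^ 2 * (δ * (L : ℝ) ^ 2 + 5 + 8 * (L : ℝ) ^ 2 / U) := by
  set n : ℕ := ⌊(1 - δ) * (L : ℝ) ^ 2 / 2⌋₊ with hn
  have hL2 : (0 : ℝ) ≤ (L : ℝ) ^ 2 := by positivity
  have hy : 0 ≤ (1 - δ) * (L : ℝ) ^ 2 / 2 := by
    have : 0 ≤ 1 - δ := by linarith
    positivity
  have hNle : (2 * (n : ℝ)) ≤ (1 - δ) * (L : ℝ) ^ 2 := by
    have hfl := Nat.floor_le hy
    linarith
  have hNge : (1 - δ) * (L : ℝ) ^ 2 - 2 ≤ 2 * (n : ℝ) := by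
    have hfl := Nat.lt_floor_add_one ((1 - δ) * (L : ℝ) ^ 2 / 2)
    linarith
  have h2n : 2 * n ≤ L ^ 2 := by
    have h : (2 * (n : ℝ)) ≤ (L : ℝ) ^ 2 := by nlinarith
    exact_mod_cast h
  have hc := crutch_groundState_carrier_ceiling_of_le hL hU hg hUg h2n hφ1 hφ
  have hNU : 2560 * (L : ℝ) ^ 2 * n / U ≤ 1280 * (L : ℝ) ^ 2 * (L : ℝ) ^ 2 / U := by
    refine div_le_div_of_nonneg_right ?_ hU.le
    have : (2 * (n : ℝ)) ≤ (L : ℝ) ^ 2 := by nlinarith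
    nlinarith
  calc (star φ ⬝ᵥ (((pairField dWaveFormFactor L)ᴴ * pairField dWaveFormFactor L) *ᵥ φ)).re
      ≤ 160 * (L : ℝ) ^ 2 * ((L : ℝ) ^ 2 - 2 * n + 3) + 2560 * (L : ℝ) ^ 2 * n / U := hc
    _ ≤ 160 * (L : ℝ) ^ 2 * (δ * (L : ℝ) ^ 2 + 5) + 1280 * (L : ℝ) ^ 2 * (L : ℝ) ^ 2 / U := by
        have : 160 * (L : ℝ) ^ 2 * ((L : ℝ) ^ 2 - 2 * n + 3) ≤
            160 * (L : ℝ) ^ 2 * (δ * (L : ℝ) ^ 2 + 5) :=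
          mul_le_mul_of_nonneg_left (by linarith) (by positivity)
        linarith
    _ = _ := by ring

/-! ### (e) The summit's order functional of crutched ground-state families -/

/-- **(e) The carrier ceiling on the summit's order functional, on the crutch plane.** Let `U > 0`,
`0 ≤ g`, `U ≥ 320 g`, `δ ∈ [0, 1]`, and let `N`, `ψ` satisfy the hypothesis clause of the summit
statement with `K_{U,g}` in place of `H_U` (written at the sides `m + 1`, as in Theorems 33–34): at
every even side `L`, `ψ L` is normalised and is a ground state of `K_{U,g}(L)` in the sector
`(2⌊(1-δ)L²/2⌋, S^z = 0)`. Then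
`liminf_k |Λ_{2k}|⁻² Σ_{x,y ∈ Λ_{2k}} torusPullback (pairFieldCorr g_d ψ) (2k) x y ≤ 160 δ + 1280/U`.
(The `k`-th term is `(2k)⁻⁴ re⟨ψ_{2k}, Δ_dᴴΔ_d ψ_{2k}⟩` by `torusLROSeq_pairFieldCorr_succ`, `≥ 0`,
and `≤ 160δ + 1280/U + 800/(2k)²` by (d′).) At `g = 0`: the tree's
`liminf_dWavePairFieldCorr_le_carrier` with doubled constants. [this work; inputs folklore] -/
theorem liminf_dWavePairFieldCorr_crutch_le_carrier {U δ g : ℝ} (hU : 0 < U) (hg : 0 ≤ g)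
    (hUg : 320 * g ≤ U) (hδ0 : 0 ≤ δ) (hδ1 : δ ≤ 1)
    (ψ : ∀ L, Fock (Orb (FermionTorus 2 L)))
    (hGS : ∀ m : ℕ, Even (m + 1) → star (ψ (m + 1)) ⬝ᵥ ψ (m + 1) = 1 ∧
      IsGroundStateInSector
        (hubbardTorus 2 (m + 1) 1 U + ((-(g / ((m + 1 : ℕ) : ℝ) ^ 2) : ℝ) : ℂ) •
          ((pairField dWaveFormFactor (m + 1))ᴴ * pairField dWaveFormFactor (m + 1)))
        (2 * ⌊(1 - δ) * ((m + 1 : ℕ) : ℝ) ^ 2 / 2⌋₊) 0 (ψ (m + 1))) :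
    liminf (fun k : ℕ => (∑ x ∈ halfOpenBox 2 (2 * k), ∑ y ∈ halfOpenBox 2 (2 * k),
        torusPullback (pairFieldCorr dWaveFormFactor ψ) (2 * k) x y) /
          ((#(halfOpenBox 2 (2 * k)) : ℝ)) ^ 2) atTop ≤
      160 * δ + 1280 / U := by
  set C : ℝ := 160 * δ + 1280 / U with hC
  set u : ℕ → ℝ := fun k => (∑ x ∈ halfOpenBox 2 (2 * k), ∑ y ∈ halfOpenBox 2 (2 * k),
      torusPullback (pairFieldCorr dWaveFormFactor ψ) (2 * k) x y) /
        ((#(halfOpenBox 2 (2 * k)) : ℝ)) ^ 2 with hu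
  change liminf u atTop ≤ C
  -- the `k`-th term for `k ≥ 1`, and its sign
  have hterm : ∀ k : ℕ, 1 ≤ k → ∃ n : ℕ, 2 * k = n + 1 ∧
      u k = (star (ψ (n + 1)) ⬝ᵥ (((pairField dWaveFormFactor (n + 1))ᴴ *
        pairField dWaveFormFactor (n + 1)) *ᵥ ψ (n + 1))).re / ((n + 1 : ℕ) : ℝ) ^ 4 := by
    intro k hk
    refine ⟨2 * k - 1, by omega, ?_⟩
    have e : 2 * k = (2 * k - 1) + 1 := by omega
    simp only [hu]
    rw [e, torusLROSeq_pairFieldCorr_succ]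
    rfl
  have hnonneg : ∀ k : ℕ, 1 ≤ k → 0 ≤ u k := by
    intro k hk
    obtain ⟨n, -, hn⟩ := hterm k hk
    rw [hn]
    refine div_nonneg ?_ (by positivity)
    exact (posSemidef_conjTranspose_mul_self (pairField dWaveFormFactor (n + 1))).re_dotProduct_nonneg
      (ψ (n + 1))
  have hbdd : IsBoundedUnder (· ≥ ·) atTop u :=
    isBoundedUnder_of_eventually_ge (a := 0)
      (Filter.eventually_atTop.2 ⟨1, fun k hk => hnonneg k hk⟩)
  -- for every `c > C`, eventually `u k ≤ c`
  have hev : ∀ c : ℝ, C < c → ∀ᶠ k in atTop, u k ≤ c := by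
    intro c hc
    have hε : 0 < c - C := by linarith
    rw [Filter.eventually_atTop]
    refine ⟨⌈800 / (c - C)⌉₊ + 2, fun k hk => ?_⟩
    obtain ⟨n, hn2, hn⟩ := hterm k (by omega)
    obtain ⟨hnorm, hgs⟩ := hGS n ⟨k, by omega⟩
    have hL3 : 3 ≤ n + 1 := by omega
    have hside := crutch_groundState_carrier_ceiling_doped (L := n + 1) hL3 hδ0 hδ1 hU hg hUg
      hnorm hgs
    have hL1 : (1 : ℝ) ≤ ((n + 1 : ℕ) : ℝ) := by exact_mod_cast (show 1 ≤ n + 1 by omega)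
    have hL2 : (0 : ℝ) < ((n + 1 : ℕ) : ℝ) ^ 2 := by positivity
    have hLk : (⌈800 / (c - C)⌉₊ : ℝ) + 2 ≤ ((n + 1 : ℕ) : ℝ) := by
      have : ⌈800 / (c - C)⌉₊ + 2 ≤ n + 1 := by omega
      exact_mod_cast this
    have hceil : 800 / (c - C) ≤ (⌈800 / (c - C)⌉₊ : ℝ) := Nat.le_ceil _
    have hdiv : 800 / (c - C) < ((n + 1 : ℕ) : ℝ) := by linarith
    have h4 : 800 < (c - C) * ((n + 1 : ℕ) : ℝ) := by
      have := (div_lt_iff₀ hε).1 hdiv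
      linarith
    rw [hn, div_le_iff₀ (by positivity)]
    refine hside.trans ?_
    -- `160 L² (δ L² + 5 + 8 L²/U) = C L⁴ + 800 L² ≤ c L⁴` for `L = n + 1 ≥ ⌈800/(c-C)⌉ + 2`
    have hsq : ((n + 1 : ℕ) : ℝ) ^ 4 = ((n + 1 : ℕ) : ℝ) ^ 2 * ((n + 1 : ℕ) : ℝ) ^ 2 := by ring
    have hexp : 160 * ((n + 1 : ℕ) : ℝ) ^ 2 *
        (δ * ((n + 1 : ℕ) : ℝ) ^ 2 + 5 + 8 * ((n + 1 : ℕ) : ℝ) ^ 2 / U) =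
        C * (((n + 1 : ℕ) : ℝ) ^ 2 * ((n + 1 : ℕ) : ℝ) ^ 2) + 800 * ((n + 1 : ℕ) : ℝ) ^ 2 := by
      simp only [hC]
      ring
    rw [hsq, hexp]
    nlinarith [mul_le_mul_of_nonneg_right hL1 hL2.le]
  -- conclude
  by_contra hlt
  push Not at hlt
  have hmid : C < (C + liminf u atTop) / 2 := by linarith
  have h := liminf_le_of_frequently_le ((hev _ hmid).frequently) hbdd
  linarith

/-! ### (f) The two-sided carrier law at strong coupling -/

/-- **(f) Theorem 40 — the two-sided carrier law for the crutch-induced order at strong coupling.**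
`δ ∈ (0, 1/2)`, `g ≥ 48`, `U ≥ 64/δ` and `U ≥ 320 g`, even side `L ≥ 4` with `L ≥ 4/δ`; `φ` a
normalised ground state of `K_{U,g} = H_U - (g/L²) Δ_dᴴΔ_d` in the sector `(2⌊(1-δ)L²/2⌋, S^z = 0)`.
Then **`δ L⁴ / g ≤ re⟨φ, Δ_dᴴΔ_d φ⟩ ≤ 180 δ L⁴ + 800 L²`**: the order density of EVERY such ground
state lies in `[δ/g, 180δ + 800/L²]` — of the exact order of the hole density, uniformly in `L`.
Floor: Theorem 34 (`DimerCondensate.strongCoupling_trial`, the Gutzwiller dimer condensate against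
the Mott floor) through Theorem 24(c) (`CrutchAxis.crutch_groundState_order_ge_of_trial`); ceiling:
(d′) with `1280/U ≤ 20 δ`. [this work] -/
theorem strongCoupling_crutch_order_two_sided (hL4 : 4 ≤ L) (hLe : Even L) {δ : ℝ}
    (hδ : δ ∈ Set.Ioo (0 : ℝ) (1 / 2)) (hLδ : 4 / δ ≤ (L : ℝ)) {U : ℝ} (hU : 64 / δ ≤ U)
    {g : ℝ} (hg : 48 ≤ g) (hUg : 320 * g ≤ U) {φ : Fock (Orb (FermionTorus 2 L))}
    (hφ1 : star φ ⬝ᵥ φ = 1)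
    (hφ : IsGroundStateInSector
      (hubbardTorus 2 L 1 U + ((-(g / (L : ℝ) ^ 2) : ℝ) : ℂ) •
        ((pairField dWaveFormFactor L)ᴴ * pairField dWaveFormFactor L))
      (2 * ⌊(1 - δ) * (L : ℝ) ^ 2 / 2⌋₊) 0 φ) :
    δ * (L : ℝ) ^ 4 / g ≤
        (star φ ⬝ᵥ (((pairField dWaveFormFactor L)ᴴ * pairField dWaveFormFactor L) *ᵥ φ)).re ∧
      (star φ ⬝ᵥ (((pairField dWaveFormFactor L)ᴴ * pairField dWaveFormFactor L) *ᵥ φ)).re ≤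
        180 * δ * (L : ℝ) ^ 4 + 800 * (L : ℝ) ^ 2 := by
  obtain ⟨hδ0, hδ1⟩ := hδ
  have hL3 : 3 ≤ L := le_trans (by norm_num) hL4
  have hL0 : (0 : ℝ) < (L : ℝ) := by exact_mod_cast (show 0 < L by omega)
  have hg0 : 0 < g := by linarith
  have hU0 : 0 < U := lt_of_lt_of_le (by positivity) hU
  constructor
  · -- floor: Theorem 34's trial state through Theorem 24(c)
    obtain ⟨Ψ, hΨK, hΨ0, hΨ⟩ := DimerCondensate.strongCoupling_trial hL4 hLe ⟨hδ0, hδ1⟩ hLδ hU hg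
    have ht : 0 < g / (L : ℝ) ^ 2 := by positivity
    have key := CrutchAxis.crutch_groundState_order_ge_of_trial (L := L) U _ ht hΨK hΨ0
      (a := δ * (L : ℝ) ^ 4 / g) ?_ hφ1 hφ
    · exact key
    · have h1 : g / (L : ℝ) ^ 2 * (δ * (L : ℝ) ^ 4 / g) = δ * (L : ℝ) ^ 2 := by
        field_simp
      rw [h1]
      exact hΨ
  · -- ceiling: (d′) with `1280/U ≤ 20δ`
    have hc := crutch_groundState_carrier_ceiling_doped hL3 hδ0.le (by linarith) hU0 hg0.le hUg
      hφ1 hφ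
    have hUinv : 8 * (L : ℝ) ^ 2 / U ≤ δ * (L : ℝ) ^ 2 / 8 := by
      rw [div_le_div_iff₀ hU0 (by norm_num)]
      have h64 : 64 ≤ δ * U := by
        have := (div_le_iff₀ hδ0).1 hU
        linarith
      nlinarith [sq_nonneg (L : ℝ)]
    have hL2 : (0 : ℝ) ≤ 160 * (L : ℝ) ^ 2 := by positivity
    calc (star φ ⬝ᵥ (((pairField dWaveFormFactor L)ᴴ * pairField dWaveFormFactor L) *ᵥ φ)).re
        ≤ 160 * (L : ℝ) ^ 2 * (δ * (L : ℝ) ^ 2 + 5 + 8 * (L : ℝ) ^ 2 / U) := hc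
      _ ≤ 160 * (L : ℝ) ^ 2 * (δ * (L : ℝ) ^ 2 + 5 + δ * (L : ℝ) ^ 2 / 8) :=
          mul_le_mul_of_nonneg_left (by linarith) hL2
      _ = 180 * δ * (L : ℝ) ^ 4 + 800 * (L : ℝ) ^ 2 := by ring

end Summit.HubbardSuperconductivity.HubbardSuperconductivity.Theorems.CrutchCarrierCeiling
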